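import Summits.Ventures.PercRepro.S1CoreCapSpecFiveThin
import Summits.Ventures.PercRepro.S1CoreCapSpecFiveFour

/-!
# PercRepro — THE INSTANCE `ν = 5` OF THE 4-CIRCUIT-CAP SPEC, PROVED: `Q*(5) = 11` (p1, gen 24)

`fourCapSpec_five : FourCapSpec capPaper 5 11`. By `S1CoreCapSpecFiveHeavy.sum_cap_le_eleven_unless` what is left is
a configuration of `≥ 3` lines all of weight `≤ 4`, i.e. simple 4-point lines (cap `4`), simple 3-point lines (cap
`1`) and one-fat 3-point lines (cap `2`). By the number of 4-point lines: three are impossible and two leave room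
for `≤ 3` further simple lines (`S1CoreCapSpecFiveFour`); with one 4-point line `L₁` the 3-point lines have budget
`3` over `L₁` (`budget_single`), so at most one fat point `p`, `≤ 2` lines through it and `≤ 1` avoiding it, or no
fat point and `≤ 6` lines — cap `≤ 10` (`sum_cap_le_ten_of_one_four`); with no 4-point line the lines have budget
`5` (`budget_empty`) and budget `4` over any one of them: no fat point ⇒ `≤ 11` lines; a fat point `p` on `A` ⇒
`≤ 6` lines beside `A` (budget `3` over `A`, which carries `p`), at most two fat points, of degree `≤ 4` (one) or
`≤ 2` each (two) — cap `= #lines + Σ deg ≤ 11` (`sum_cap_le_eleven_of_no_four`). The bound is attained by two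
4-point lines through a point with three transversals through a further point. `proofs/P1-S4-CAPBRIDGE.md` §16.
Axioms: standard.
-/

namespace PercRepro

namespace S1

namespace FourCap

variable {β : Type} [DecidableEq β]

section FiveCases

variable {w : β → ℕ} {ls : Finset (Finset β)}
  (h1 : ∀ L ∈ ls, ∀ v ∈ L, w v = 1 ∨ w v = 2)
  (h2 : ∀ L ∈ ls, 3 ≤ L.card ∧ wsum w L ≤ 5)
  (h3 : ∀ L ∈ ls, ∀ L' ∈ ls, L ≠ L' → (L ∩ L').card ≤ 1)
  (h4 : ∀ l : List (Finset β), l.Nodup → (∀ L ∈ l, L ∈ ls) → wsum w (unionL l) ≤ 5 + lineRank l)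
  (hw4 : ∀ L ∈ ls, wsum w L ≤ 4)

include h1 h4 in
/-- **Budget `5` over nothing**: a list of 3-point lines of the configuration has `freeCountR ∅ + fat ≤ 5`. -/
theorem budget_empty (l : List (Finset β)) (hnd : l.Nodup) (hl : ∀ L ∈ l, L ∈ ls) (h3l : ∀ L ∈ l, L.card = 3) :
    freeCountR ∅ l + fat w (unionLR ∅ l) ≤ 5 := by
  have h := freeCountR_add_fat_le h1 h4 [] l (by simpa using hnd) (by simpa using hl) h3l
  simp only [unionL, lineRank, Finset.card_empty, Nat.zero_add, Nat.add_zero] at h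
  exact h

include h1 h4 in
/-- **Budget over one line**: a list of 3-point lines placed after a line `L₀` of the configuration has
`|L₀| + freeCountR L₀ + fat ≤ 7`. -/
theorem budget_single {L₀ : Finset β} (hL₀ : L₀ ∈ ls) (hk : 3 ≤ L₀.card) (l : List (Finset β)) (hnd : l.Nodup)
    (hL₀l : L₀ ∉ l) (hl : ∀ L ∈ l, L ∈ ls) (h3l : ∀ L ∈ l, L.card = 3) :
    L₀.card + freeCountR L₀ l + fat w (unionLR L₀ l) ≤ 7 := by
  have hnd' : (l ++ [L₀]).Nodup :=
    List.Nodup.append hnd (List.nodup_singleton _) (fun a ha hb => hL₀l (List.mem_singleton.1 hb ▸ ha))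
  have hl' : ∀ L ∈ l ++ [L₀], L ∈ ls := by
    intro L hL
    rcases List.mem_append.1 hL with h | h
    · exact hl L h
    · rw [List.mem_singleton.1 h]; exact hL₀
  have h := freeCountR_add_fat_le h1 h4 [L₀] l hnd' hl' h3l
  have hU : unionL [L₀] = L₀ := by simp [unionL]
  have hR : lineRank [L₀] = 2 := by
    simp only [lineRank, unionL, Finset.sdiff_empty, Finset.inter_empty, Finset.card_empty]
    omega
  rw [hU, hR] at h
  omega

include h1 h3 h4 hw4 in
/-- **One 4-point line: cap sum `≤ 10`.** The 3-point lines have budget `3` over `L₁`: with no fat point there are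
`≤ 6` of them (cap `4 + 6`); with a fat point `p` (at most one: a second would leave no line through `p`) there are
`≤ 2` lines through `p` and `≤ 1` avoiding it (cap `≤ 4 + 3 + 2`). -/
theorem sum_cap_le_ten_of_one_four {L₁ : Finset β} (hL₁ : L₁ ∈ ls) (c1 : L₁.card = 4)
    (hrest : ∀ L ∈ ls, L ≠ L₁ → L.card = 3) : ∑ L ∈ ls, capPaper L.card (fat w L) ≤ 10 := by
  set T := ls.erase L₁ with hT
  have hTmem : ∀ L ∈ T, L ∈ ls ∧ L ≠ L₁ := fun L hL => by
    rw [hT, Finset.mem_erase] at hL; exact ⟨hL.2, hL.1⟩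
  have hT3 : ∀ L ∈ T, L.card = 3 ∧ (L ∩ L₁).card ≤ 1 := fun L hL =>
    ⟨hrest L (hTmem L hL).1 (hTmem L hL).2, h3 L (hTmem L hL).1 L₁ hL₁ (hTmem L hL).2⟩
  have hTpair : ∀ L ∈ T, ∀ L' ∈ T, L ≠ L' → (L ∩ L').card ≤ 1 := fun L hL L' hL' hne =>
    h3 L (hTmem L hL).1 L' (hTmem L' hL').1 hne
  have hTw : ∀ L ∈ T, ∀ v ∈ L, w v = 1 ∨ w v = 2 := fun L hL => h1 L (hTmem L hL).1
  have hTw4 : ∀ L ∈ T, wsum w L ≤ 4 := fun L hL => hw4 L (hTmem L hL).1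
  have hB : ∀ l : List (Finset β), l.Nodup → (∀ L ∈ l, L ∈ T) →
      freeCountR L₁ l + fat w (unionLR L₁ l) ≤ 3 := by
    intro l hnd hl
    have h := budget_single h1 h4 hL₁ (by omega) l hnd (fun h => (hTmem L₁ (hl L₁ h)).2 rfl)
      (fun L hL => (hTmem L (hl L hL)).1) (fun L hL => (hT3 L (hl L hL)).1)
    omega
  have hsimple : fat w L₁ = 0 := (simple_of_card_four (h1 L₁ hL₁) (hw4 L₁ hL₁) c1).1
  have hpP : ∀ p, w p = 2 → p ∉ L₁ := fun p hp2 hpL =>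
    by have := weight_one_of_fat_zero (h1 L₁ hL₁) hsimple hpL; omega
  -- the cap sum splits as `4 + #T + Σ_T fat`
  have hcap1 : capPaper L₁.card (fat w L₁) = 4 := by rw [c1, hsimple]; decide
  rw [← Finset.add_sum_erase ls _ hL₁, hcap1, ← hT,
    sum_cap_eq_card_add_sum_fat (fun L hL => (hT3 L hL).1) hTw hTw4, sum_fat_eq_sum_deg]
  -- the fat points of `T`
  rcases (by omega : (fatPoints w T).card = 0 ∨ (fatPoints w T).card = 1 ∨ 1 < (fatPoints w T).card)
    with h0 | hone | htwo
  · -- no fat point: `≤ 6` lines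
    rw [Finset.card_eq_zero.1 h0, Finset.sum_empty]
    have := card_le_of_budget hT3 hTpair hB
    omega
  · obtain ⟨p, hp⟩ := Finset.card_eq_one.1 hone
    have hpF : p ∈ fatPoints w T := hp ▸ Finset.mem_singleton_self p
    obtain ⟨⟨A, hA, hpA⟩, hp2⟩ := mem_fatPoints.1 hpF
    rw [hp, Finset.sum_singleton]
    have hdeg := deg_fat_le hT3 hTpair hB (hpP p hp2) hp2 hA hpA
    have hnot := budget_not_through hB (hpP p hp2) hp2 hA hpA
    have hcount := two_mul_card_le_of_freeCountR L₁ 1 (T.filter (fun L => p ∉ L))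
      (fun L hL => hT3 L (Finset.mem_filter.1 hL).1)
      (fun L hL L' hL' hne => hTpair L (Finset.mem_filter.1 hL).1 L' (Finset.mem_filter.1 hL').1 hne)
      (fun l hnd hl => by have := hnot l hnd hl; omega)
    have hsplit := Finset.card_filter_add_card_filter_not (s := T) (fun L => p ∈ L)
    omega
  · exfalso
    obtain ⟨p, hpF, q, hqF, hpq⟩ := Finset.one_lt_card.1 htwo
    obtain ⟨⟨A, hA, hpA⟩, hp2⟩ := mem_fatPoints.1 hpF
    obtain ⟨⟨B, hB', hqB⟩, hq2⟩ := mem_fatPoints.1 hqF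
    have h := deg_fat_le_of_two hT3 hTpair hTw hTw4 hB (hpP p hp2) (hpP q hq2) hp2 hq2 hpq hA hpA hB' hqB
    have : 0 < (T.filter (fun L => p ∈ L)).card := Finset.card_pos.2 ⟨A, Finset.mem_filter.2 ⟨hA, hpA⟩⟩
    omega

include h1 h2 h3 h4 hw4 in
/-- **No 4-point line: cap sum `≤ 11`.** With no fat point the lines have budget `4` over any one of them, so
there are `≤ 1 + 10` (cap `= #lines`). With a fat point `p` on `A`, the other lines have `≤ 3` free lines over `A`
(which carries `p`), so `≤ 1 + 6` lines; at most two fat points (three cost `3 + 3`), through which pass `≤ 4`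
lines (one fat point) or `≤ 2` each (two): cap `= #lines + Σ deg ≤ 7 + 4`. -/
theorem sum_cap_le_eleven_of_no_four (hall : ∀ L ∈ ls, L.card = 3) :
    ∑ L ∈ ls, capPaper L.card (fat w L) ≤ 11 := by
  have hT3 : ∀ L ∈ ls, L.card = 3 ∧ (L ∩ (∅ : Finset β)).card ≤ 1 := fun L hL => by
    simp [hall L hL]
  have hB : ∀ l : List (Finset β), l.Nodup → (∀ L ∈ l, L ∈ ls) →
      freeCountR ∅ l + fat w (unionLR ∅ l) ≤ 5 :=
    fun l hnd hl => budget_empty h1 h4 l hnd hl (fun L hL => hall L (hl L hL))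
  have hpP : ∀ p : β, p ∉ (∅ : Finset β) := fun p => Finset.notMem_empty p
  rw [sum_cap_eq_card_add_sum_fat hall h1 hw4, sum_fat_eq_sum_deg]
  -- the other lines over one line `L₀`: budget `k` on the free count ⇒ `#ls ≤ 1 + k (k + 1) / 2`
  have hover : ∀ L₀ ∈ ls, ∀ k : ℕ,
      (∀ l : List (Finset β), l.Nodup → (∀ L ∈ l, L ∈ ls.erase L₀) → freeCountR L₀ l ≤ k) →
      2 * ls.card ≤ 2 + k * (k + 1) := by
    intro L₀ hL₀ k hk
    have h := two_mul_card_le_of_freeCountR L₀ k (ls.erase L₀)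
      (fun L hL => ⟨hall L (Finset.mem_erase.1 hL).2, h3 L (Finset.mem_erase.1 hL).2 L₀ hL₀ (Finset.mem_erase.1 hL).1⟩)
      (fun L hL L' hL' hne => h3 L (Finset.mem_erase.1 hL).2 L' (Finset.mem_erase.1 hL').2 hne) hk
    rw [Finset.card_erase_of_mem hL₀] at h
    have := Finset.card_pos.2 ⟨L₀, hL₀⟩
    omega
  rcases (by omega : (fatPoints w ls).card = 0 ∨ (fatPoints w ls).card = 1 ∨ (fatPoints w ls).card = 2 ∨
      2 < (fatPoints w ls).card) with h0 | hone | htwo | hthree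
  · -- no fat point: `≤ 11` lines
    rw [Finset.card_eq_zero.1 h0, Finset.sum_empty]
    rcases Finset.eq_empty_or_nonempty ls with hempty | ⟨L₀, hL₀⟩
    · subst hempty; simp
    have h := hover L₀ hL₀ 4 (fun l hnd hl => by
      have := budget_single h1 h4 hL₀ (by rw [hall L₀ hL₀]) l hnd (fun h => (Finset.mem_erase.1 (hl L₀ h)).1 rfl)
        (fun L hL => (Finset.mem_erase.1 (hl L hL)).2) (fun L hL => hall L (Finset.mem_erase.1 (hl L hL)).2)
      rw [hall L₀ hL₀] at this
      omega)
    omega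
  · -- one fat point `p` on `A`: `≤ 7` lines, `≤ 4` through `p`
    obtain ⟨p, hp⟩ := Finset.card_eq_one.1 hone
    have hpF : p ∈ fatPoints w ls := hp ▸ Finset.mem_singleton_self p
    obtain ⟨⟨A, hA, hpA⟩, hp2⟩ := mem_fatPoints.1 hpF
    rw [hp, Finset.sum_singleton]
    have hdeg := deg_fat_le hT3 h3 hB (hpP p) hp2 hA hpA
    have h := hover A hA 3 (fun l hnd hl => by
      have := budget_single h1 h4 hA (by rw [hall A hA]) l hnd (fun h => (Finset.mem_erase.1 (hl A h)).1 rfl)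
        (fun L hL => (Finset.mem_erase.1 (hl L hL)).2) (fun L hL => hall L (Finset.mem_erase.1 (hl L hL)).2)
      have hfat : 1 ≤ fat w (unionLR A l) := one_le_fat (subset_unionLR A l hpA) hp2
      rw [hall A hA] at this
      omega)
    omega
  · -- two fat points `p, q`: `≤ 7` lines, `≤ 2` through each
    obtain ⟨p, q, hpq, hpq'⟩ := Finset.card_eq_two.1 htwo
    have hpF : p ∈ fatPoints w ls := hpq' ▸ Finset.mem_insert_self p {q}
    have hqF : q ∈ fatPoints w ls := hpq' ▸ Finset.mem_insert_of_mem (Finset.mem_singleton_self q)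
    obtain ⟨⟨A, hA, hpA⟩, hp2⟩ := mem_fatPoints.1 hpF
    obtain ⟨⟨B, hB', hqB⟩, hq2⟩ := mem_fatPoints.1 hqF
    rw [hpq', Finset.sum_pair hpq]
    have hdegp := deg_fat_le_of_two hT3 h3 h1 hw4 hB (hpP p) (hpP q) hp2 hq2 hpq hA hpA hB' hqB
    have hdegq := deg_fat_le_of_two hT3 h3 h1 hw4 hB (hpP q) (hpP p) hq2 hp2 hpq.symm hB' hqB hA hpA
    have h := hover A hA 3 (fun l hnd hl => by
      have := budget_single h1 h4 hA (by rw [hall A hA]) l hnd (fun h => (Finset.mem_erase.1 (hl A h)).1 rfl)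
        (fun L hL => (Finset.mem_erase.1 (hl L hL)).2) (fun L hL => hall L (Finset.mem_erase.1 (hl L hL)).2)
      have hfat : 1 ≤ fat w (unionLR A l) := one_le_fat (subset_unionLR A l hpA) hp2
      rw [hall A hA] at this
      omega)
    omega
  · -- three fat points: impossible
    exfalso
    obtain ⟨p, hpF, q, hqF, r, hrF, hpq, hpr, hqr⟩ := Finset.two_lt_card.1 hthree
    obtain ⟨⟨A, hA, hpA⟩, hp2⟩ := mem_fatPoints.1 hpF
    obtain ⟨⟨B, hB', hqB⟩, hq2⟩ := mem_fatPoints.1 hqF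
    obtain ⟨⟨C, hC, hrC⟩, hr2⟩ := mem_fatPoints.1 hrF
    have := not_three_fat hT3 h1 hw4 hB (hpP p) (hpP q) (hpP r) hp2 hq2 hr2 hpq hpr hqr hA hpA hB' hqB hC hrC
    omega

include h1 h2 h3 h4 hw4 in
/-- **The remaining case of `Q*(5) = 11`**: every configuration at nullity `5` all of whose lines have weight `≤ 4`
has cap sum `≤ 11` — by the number of 4-point lines (`≥ 3` impossible, `2` by `S1CoreCapSpecFiveFour`, `1` and `0`
above). -/
theorem sum_cap_le_eleven_of_weight_le_four : ∑ L ∈ ls, capPaper L.card (fat w L) ≤ 11 := by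
  set F := ls.filter (fun L => L.card = 4) with hF
  have hFmem : ∀ L ∈ F, L ∈ ls ∧ L.card = 4 := fun L hL => Finset.mem_filter.1 hL
  have hcard3 : ∀ L ∈ ls, L ∉ F → L.card = 3 := by
    intro L hL hLF
    rcases card_three_or_four (h1 L hL) (hw4 L hL) (h2 L hL).1 with h | h
    · exact h.1
    · exact absurd (Finset.mem_filter.2 ⟨hL, h.1⟩) hLF
  rcases (by omega : F.card = 0 ∨ F.card = 1 ∨ F.card = 2 ∨ 2 < F.card) with h0 | hone | htwo | hthree
  · refine sum_cap_le_eleven_of_no_four h1 h2 h3 h4 hw4 (fun L hL => hcard3 L hL ?_)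
    rw [Finset.card_eq_zero.1 h0]
    exact Finset.notMem_empty L
  · obtain ⟨L₁, hL₁⟩ := Finset.card_eq_one.1 hone
    have hL₁F : L₁ ∈ F := hL₁ ▸ Finset.mem_singleton_self L₁
    refine (sum_cap_le_ten_of_one_four h1 h3 h4 hw4 (hFmem L₁ hL₁F).1 (hFmem L₁ hL₁F).2
      (fun L hL hne => hcard3 L hL ?_)).trans (by omega)
    rw [hL₁]
    exact fun h => hne (Finset.mem_singleton.1 h)
  · obtain ⟨L₁, L₂, hne, hF2⟩ := Finset.card_eq_two.1 htwo
    have hL₁F : L₁ ∈ F := hF2 ▸ Finset.mem_insert_self L₁ {L₂}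
    have hL₂F : L₂ ∈ F := hF2 ▸ Finset.mem_insert_of_mem (Finset.mem_singleton_self L₂)
    exact sum_cap_le_eleven_of_two_four h1 h2 h3 h4 hw4 (hFmem L₁ hL₁F).1 (hFmem L₂ hL₂F).1 hne.symm
      (hFmem L₁ hL₁F).2 (hFmem L₂ hL₂F).2
  · exfalso
    obtain ⟨L₁, hL₁, L₂, hL₂, L₃, hL₃, h12, h13, h23⟩ := Finset.two_lt_card.1 hthree
    exact not_three_four h1 h3 h4 hw4 (hFmem L₁ hL₁).1 (hFmem L₂ hL₂).1 (hFmem L₃ hL₃).1 h12.symm h13.symm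
      h23.symm (hFmem L₁ hL₁).2 (hFmem L₂ hL₂).2 (hFmem L₃ hL₃).2

end FiveCases

/-- **THE INSTANCE `ν = 5`, PROVED**: `FourCapSpec capPaper 5 11` — the searches' `Q*(5) = 11` is a theorem. -/
theorem fourCapSpec_five : FourCapSpec capPaper 5 11 := by
  intro β _ w ls h1 h2 h3 h4 _ _
  exact sum_cap_le_eleven_unless h1 h2 h3 h4
    (fun _ hw4 => sum_cap_le_eleven_of_weight_le_four h1 h2 h3 h4 hw4)

end FourCap

end S1

end PercRepro
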